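import Summits.ABC.StewartYu.GenThreeBaseTwo
import HarnessLib

/-!
# Cell abc-stewartyu, Gen-3 frame at `p = 2` (crux `Y07Two`, stmt-ABC-19659), layer F7b: PIVOT NORMALISATION —
# the frame is owed only for data whose pivot (a nonzero coefficient of minimal `2`-adic order) is the LAST index

`Summits/ABC/StewartYu/GenThreeFramePivotTwo.lean` — cell `abc-stewartyu` (HOME `run/shared/lean/pub/abc-stewartyu/`),
route `PadicPrimesKummerThird`, seat p3 (g5), F-two LEAD.  One `Prop`-valued predicate and theorems; sequel to
`GenThreeFrameSpecTwo` / `GenThreeBaseTwo`.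

The analytic frame lives on the M2 datum `TwoSetup` (`d` free generators + the ELIMINATED one `θ`, whose
coefficient `b_θ ≠ 0` has minimal `2`-adic order — Yu's normalisation `ord_p bₙ ≤ ord_p bⱼ`).  The internal
statement `DichotomyTwo C n` quantifies over arbitrary data on `Fin n`.  Since the dichotomy's conclusion only
sees `∏ⱼ αⱼ^{bⱼ}` and `∏ⱼ Vⱼ`, it is invariant under permutations of the indices (`conclusion_of_perm`), so the
frame may be stated for PIVOT-LAST data only:

* `FrameTwoLast C d` — for data on `Fin (d+1)` with `b (last) ≠ 0` of minimal `2`-adic order among the nonzero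
  `bⱼ`, under the negated bound: `FrameOutputTwo (d+1) α b (Fin.last d) …` and `RecordTwo …` for some parameters;
* `dichotomy_of_frame_pointwise` — the pointwise content of `GenThreeFrameSpecTwo.dichotomyTwo_of_frame`;
* `dichotomyTwo_of_frameLast` — `FrameTwoLast C d ⇒ DichotomyTwo C (d+1)` (choose the pivot, swap it to the last
  place, run the frame, transport back);
* `engineTwo_of_frameLast_two_le` — the frozen engine text from the zero estimate, an admissible `C` with
  `4 ≤ C 1`, and `∀ d ≥ 1, FrameTwoLast C d`.

WHAT THIS IS NOT: no frame; no crux moves.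

References: K. Yu, Acta Math. 211 (2013), §1 (the normalisation `ord_p bₙ = min`); Yu. V. Nesterenko, LNM 1819
(2003), §5.
-/

noncomputable section

open Finset
open Literature.NumberTheory.Transcendental

namespace Summit.ABC.StewartYu.GenThreeFramePivotTwo

open Summit.ABC.StewartYu.GenThreeInductionTwo
open Summit.ABC.StewartYu.GenThreeStepTwo
open Summit.ABC.StewartYu.GenThreeEndExits
open Summit.ABC.StewartYu.GenThreeFrameSpecTwo
open Summit.ABC.StewartYu.GenThreeBaseTwo

/-- **THE FRAME FOR PIVOT-LAST DATA** on `Fin (d+1)`: `b (last) ≠ 0` has minimal `2`-adic order among the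
nonzero coefficients; under the negated bound, the frame output with pivot `Fin.last d` and the record
obligations for some parameters. [cite: Yu2013, §1; shape only] -/
def FrameTwoLast (C : ℕ → ℝ) (d : ℕ) : Prop :=
  ∀ (α : Fin (d + 1) → ℚ) (b : Fin (d + 1) → ℤ) (V : Fin (d + 1) → ℝ) (Vmax W : ℝ),
    (∀ j, 3 ≤ padicValRat 2 (α j - 1)) →
    (∀ μ : Fin (d + 1) → ℤ, ∏ j, α j ^ μ j = 1 → μ = 0) →
    (∀ κ : Fin (d + 1) → ℤ, (∃ γ : ℚ, ∏ j, α j ^ κ j = γ ^ 3) → ∀ j, (3 : ℤ) ∣ κ j) →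
    (∀ j, Height.logHeight₁ (α j) ≤ V j) → (∀ j, 1 ≤ V j) → (∀ j, V j ≤ Vmax) →
    b (Fin.last d) ≠ 0 →
    (∀ j, b j ≠ 0 → padicValInt 2 (b (Fin.last d)) ≤ padicValInt 2 (b j)) →
    (∀ j, Real.log (max 3 (|b j| : ℝ)) ≤ W) → 1 ≤ W →
    ¬ (padicValRat 2 (∏ j, α j ^ b j - 1) : ℝ) ≤ C (d + 1) * (∏ j, V j) * (W + Real.log (2 * Vmax)) →
    ∃ (D₀ S₀ X : ℕ) (D : Fin (d + 1) → ℕ),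
      FrameOutputTwo (d + 1) α b (Fin.last d) D₀ S₀ X D ∧ RecordTwo C (d + 1) V Vmax W D₀ S₀ X D

/-! ### The pointwise content of `dichotomyTwo_of_frame` -/

/-- For FIXED rank-`n` data: frame output with some pivot + record ⇒ bound ∨ step. (The body of
`GenThreeFrameSpecTwo.dichotomyTwo_of_frame`.) [cite: Nesterenko2003, §5.2] -/
theorem dichotomy_of_frame_pointwise (hZ : Nesterenko2003_prop51) {C : ℕ → ℝ} (hC0 : ∀ r, 0 ≤ C r) {n : ℕ}
    (α : Fin n → ℚ) (b : Fin n → ℤ) (V : Fin n → ℝ) (Vmax W : ℝ)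
    (hα : ∀ j, 3 ≤ padicValRat 2 (α j - 1))
    (hind : ∀ μ : Fin n → ℤ, ∏ j, α j ^ μ j = 1 → μ = 0)
    (hK : ∀ κ : Fin n → ℤ, (∃ γ : ℚ, ∏ j, α j ^ κ j = γ ^ 3) → ∀ j, (3 : ℤ) ∣ κ j)
    (hV : ∀ j, Height.logHeight₁ (α j) ≤ V j) (hV1 : ∀ j, 1 ≤ V j) (hVmax : ∀ j, V j ≤ Vmax)
    (hb : b ≠ 0) (hW : ∀ j, Real.log (max 3 (|b j| : ℝ)) ≤ W) (hW1 : 1 ≤ W)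
    {j₀ : Fin n} (hbj₀ : b j₀ ≠ 0) {D₀ S₀ X : ℕ} {D : Fin n → ℕ}
    (hout : FrameOutputTwo n α b j₀ D₀ S₀ X D) (hrec : RecordTwo C n V Vmax W D₀ S₀ X D) :
    (padicValRat 2 (∏ j, α j ^ b j - 1) : ℝ) ≤ C n * (∏ j, V j) * (W + Real.log (2 * Vmax)) ∨
      StepTwo C n α b V Vmax W := by
  classical
  obtain ⟨hrecA, hrecB, hrecC⟩ := hrec
  obtain ⟨I, q, i₀, ha, hκ, hi₀, hq, hL⟩ := hout
  have hα0 : ∀ j, α j ≠ 0 := fun j => TwoSetup.ne_zero_of_three_le (hα j)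
  have hinj : Set.InjOn (fun i : ℕ × (Fin n → ℤ) => (i.1, i.2)) (I : Set (ℕ × (Fin n → ℤ))) := by
    intro x _ y _ h
    exact Prod.ext (congrArg Prod.fst h) (congrArg Prod.snd h)
  obtain ⟨H, r, M, hrn, hd, hM, hchars, hexits⟩ :=
    exists_exits_rat hZ α hα0 hind b j₀ hbj₀ (bHyperplane b) (mem_bHyperplane b) I Prod.fst Prod.snd q
      D₀ S₀ X D ha hκ hinj hi₀ hq hL
  rcases hexits with ⟨_hnex, hineqA⟩ | ⟨hex, hineqC⟩
  · exact absurd hineqA (hrecA r H.addDim M hrn hd hM)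
  · rcases Nat.lt_or_ge r n with hlt | hge
    · right
      have hr0 : 0 < r := pos_of_exitC b hb (fun i => M i) hex
      have hbM := span_rat_of_exitC b (fun i => M i) hex
      exact stepTwo_of_exitC hr0 hlt (hC0 r) α hα hind hK V Vmax W hV hV1 hVmax b hb hW hW1 H
        (fun i => M i) hM hchars hbM (hrecC r H.addDim M hr0 hlt hd hM hineqC)
    · have hrn' : r = n := le_antisymm hrn hge
      subst hrn'
      exact absurd hineqC (hrecB H.addDim M hd hM)

/-! ### Permutation transport -/

/-- **The dichotomy's conclusion is invariant under a permutation of the indices** (it only sees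
`∏ⱼ αⱼ^{bⱼ}` and `∏ⱼ Vⱼ`). [folklore] -/
theorem conclusion_of_perm {C : ℕ → ℝ} {n : ℕ} (σ : Equiv.Perm (Fin n)) (α : Fin n → ℚ)
    (b : Fin n → ℤ) (V : Fin n → ℝ) (Vmax W : ℝ)
    (h : (padicValRat 2 (∏ j, (α ∘ σ) j ^ (b ∘ σ) j - 1) : ℝ) ≤
        C n * (∏ j, (V ∘ σ) j) * (W + Real.log (2 * Vmax)) ∨
      StepTwo C n (α ∘ σ) (b ∘ σ) (V ∘ σ) Vmax W) :
    (padicValRat 2 (∏ j, α j ^ b j - 1) : ℝ) ≤ C n * (∏ j, V j) * (W + Real.log (2 * Vmax)) ∨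
      StepTwo C n α b V Vmax W := by
  have e1 : ∏ j, (α ∘ σ) j ^ (b ∘ σ) j = ∏ j, α j ^ b j :=
    Equiv.prod_comp σ (fun j => α j ^ b j)
  have e2 : ∏ j, (V ∘ σ) j = ∏ j, V j := Equiv.prod_comp σ V
  simp only [StepTwo, e1, e2] at h ⊢
  exact h

/-- Transport of the HYPOTHESES along a permutation. [folklore] -/
theorem hyps_perm {n : ℕ} (σ : Equiv.Perm (Fin n)) (α : Fin n → ℚ) (b : Fin n → ℤ)
    (hind : ∀ μ : Fin n → ℤ, ∏ j, α j ^ μ j = 1 → μ = 0)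
    (hK : ∀ κ : Fin n → ℤ, (∃ γ : ℚ, ∏ j, α j ^ κ j = γ ^ 3) → ∀ j, (3 : ℤ) ∣ κ j) (hb : b ≠ 0) :
    (∀ μ : Fin n → ℤ, ∏ j, (α ∘ σ) j ^ μ j = 1 → μ = 0) ∧
    (∀ κ : Fin n → ℤ, (∃ γ : ℚ, ∏ j, (α ∘ σ) j ^ κ j = γ ^ 3) → ∀ j, (3 : ℤ) ∣ κ j) ∧
    (b ∘ σ) ≠ 0 := by
  -- `∏ⱼ α(σ j)^{μ j} = ∏ᵢ αᵢ^{μ (σ⁻¹ i)}`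
  have reidx : ∀ μ : Fin n → ℤ, ∏ j, (α ∘ σ) j ^ μ j = ∏ i, α i ^ (μ ∘ σ.symm) i := by
    intro μ
    rw [← Equiv.prod_comp σ (fun i => α i ^ (μ ∘ σ.symm) i)]
    refine Finset.prod_congr rfl fun j _ => ?_
    simp [Function.comp, Equiv.symm_apply_apply]
  refine ⟨?_, ?_, ?_⟩
  · intro μ hμ
    rw [reidx] at hμ
    have h0 := hind _ hμ
    funext j
    have := congrFun h0 (σ j)
    simpa [Function.comp, Equiv.symm_apply_apply] using this
  · intro κ hκ j
    rw [reidx] at hκ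
    have h0 := hK _ hκ (σ j)
    simpa [Function.comp, Equiv.symm_apply_apply] using h0
  · intro h0
    apply hb
    funext i
    have := congrFun h0 (σ.symm i)
    simpa [Function.comp, Equiv.apply_symm_apply] using this

/-! ### From the pivot-last frame to the dichotomy -/

/-- **`FrameTwoLast C d ⇒ DichotomyTwo C (d+1)`**: choose a nonzero coefficient of minimal `2`-adic order,
swap it to the last place, run the pivot-last frame, transport back. [cite: Yu2013, §1; shape only] -/
theorem dichotomyTwo_of_frameLast (hZ : Nesterenko2003_prop51) {C : ℕ → ℝ} (hC0 : ∀ r, 0 ≤ C r) {d : ℕ}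
    (hF : FrameTwoLast C d) : DichotomyTwo C (d + 1) := by
  classical
  intro α b V Vmax W hα hind hK hV hV1 hVmax hb hW hW1
  -- a nonzero coefficient of minimal `2`-adic order
  have hne : (Finset.univ.filter fun j => b j ≠ 0).Nonempty := by
    by_contra h0
    rw [Finset.not_nonempty_iff_eq_empty, Finset.filter_eq_empty_iff] at h0
    apply hb; funext j
    have := h0 (Finset.mem_univ j)
    push Not at this
    exact this
  obtain ⟨j₀, hj₀mem, hj₀min⟩ :=
    Finset.exists_min_image (Finset.univ.filter fun j => b j ≠ 0) (fun j => padicValInt 2 (b j)) hne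
  have hbj₀ : b j₀ ≠ 0 := (Finset.mem_filter.mp hj₀mem).2
  -- the swap
  set σ : Equiv.Perm (Fin (d + 1)) := Equiv.swap (Fin.last d) j₀ with hσ
  have hσlast : σ (Fin.last d) = j₀ := by rw [hσ, Equiv.swap_apply_left]
  obtain ⟨hind', hK', hb'⟩ := hyps_perm σ α b hind hK hb
  refine conclusion_of_perm σ α b V Vmax W ?_
  -- either the bound holds for the permuted data, or the frame runs
  by_cases hle : (padicValRat 2 (∏ j, (α ∘ σ) j ^ (b ∘ σ) j - 1) : ℝ) ≤
      C (d + 1) * (∏ j, (V ∘ σ) j) * (W + Real.log (2 * Vmax))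
  · exact Or.inl hle
  have hlast : (b ∘ σ) (Fin.last d) ≠ 0 := by
    simp only [Function.comp, hσlast]; exact hbj₀
  have hmin : ∀ j, (b ∘ σ) j ≠ 0 → padicValInt 2 ((b ∘ σ) (Fin.last d)) ≤ padicValInt 2 ((b ∘ σ) j) := by
    intro j hj
    simp only [Function.comp, hσlast] at hj ⊢
    exact hj₀min (σ j) (Finset.mem_filter.mpr ⟨Finset.mem_univ _, hj⟩)
  obtain ⟨D₀, S₀, X, D, hout, hrec⟩ :=
    hF (α ∘ σ) (b ∘ σ) (V ∘ σ) Vmax W (fun j => hα (σ j)) hind' hK' (fun j => hV (σ j))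
      (fun j => hV1 (σ j)) (fun j => hVmax (σ j)) hlast hmin (fun j => hW (σ j)) hW1 hle
  exact dichotomy_of_frame_pointwise hZ hC0 (α ∘ σ) (b ∘ σ) (V ∘ σ) Vmax W (fun j => hα (σ j)) hind'
    hK' (fun j => hV (σ j)) (fun j => hV1 (σ j)) (fun j => hVmax (σ j)) hb' (fun j => hW (σ j)) hW1
    hlast hout hrec

/-- **The frozen `GenThreeEngineTwo` text from the zero estimate, an admissible `C ≤ c₁ⁿ` with `4 ≤ C 1`, and
the PIVOT-LAST frame at every `d ≥ 1`** (rank `n = d + 1 ≥ 2`; ranks `0, 1` are `GenThreeBaseTwo`).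
[cite: Yu2007, Main Thm (K = ℚ, ℘ = 2); shape only] -/
theorem engineTwo_of_frameLast_two_le {C : ℕ → ℝ} {c₁ : ℝ} (hc₁ : 1 ≤ c₁)
    (hC : ∀ m, 0 ≤ C m ∧ C m ≤ c₁ ^ m) (hC1 : 4 ≤ C 1)
    (hF : Nesterenko2003_prop51 → ∀ d, 1 ≤ d → FrameTwoLast C d) (hZ : Nesterenko2003_prop51) :
    ∃ (C : ℕ → ℝ) (c₁ : ℝ), 1 ≤ c₁ ∧ (∀ m, 0 ≤ C m ∧ C m ≤ c₁ ^ m) ∧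
      ∀ (m : ℕ) (α : Fin m → ℚ) (b : Fin m → ℤ) (V : Fin m → ℝ) (Vmax W : ℝ),
        (∀ j, ∃ a : ℤ, α j = a) →
        (∀ j, 3 ≤ padicValRat 2 (α j - 1)) →
        (∀ μ : Fin m → ℤ, ∏ j, α j ^ μ j = 1 → μ = 0) →
        (∀ κ : Fin m → ℕ, (∃ j, ¬ 3 ∣ κ j) → ∀ γ : ℚ, ∏ j, α j ^ κ j ≠ γ ^ 3) →
        (∀ j, Height.logHeight₁ (α j) ≤ V j) → (∀ j, 1 ≤ V j) → (∀ j, V j ≤ Vmax) →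
        b ≠ 0 → (∀ j, Real.log (max 3 (|b j| : ℝ)) ≤ W) → 1 ≤ W →
        (padicValRat 2 (∏ j, α j ^ b j - 1) : ℝ) ≤ C m * (∏ j, V j) * (W + Real.log (2 * Vmax)) := by
  refine engineTwo_of_dichotomy hc₁ hC (fun hZ' n => ?_) hZ
  rcases Nat.lt_or_ge n 2 with hn | hn
  · interval_cases n
    · exact dichotomyTwo_zero C
    · exact dichotomyTwo_one hC1
  · obtain ⟨d, rfl⟩ : ∃ d, n = d + 1 := ⟨n - 1, by omega⟩
    exact dichotomyTwo_of_frameLast hZ' (fun r => (hC r).1) (hF hZ' d (by omega))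

end Summit.ABC.StewartYu.GenThreeFramePivotTwo

end
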